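/-
Copyright (c) 2026 the pub-hodgecm-mathlib formalisation cell (harness21).  Prover seat hodgecm-mathlib-A-p16 (g32): road «S3-ram» (LEAD F0P3a-plan (g12 → g13); owner∕table
F0P3a-p06 (g15)), the (a2) JUNCTION (J★) of F0P3a-p01 (g17) — the junction pen's SELF-SOCKET `charpoly_of_eigenframe` of skeleton v3 44f18c65 :406 ∕ v4 e89e5e06 :479,
statement VERBATIM; 2026-09-02.  (The twin self-socket `fixedSet_finite_of_eigenframe` is ★ p847574 `finite_setOf_latticeGraphIso_eq_of_eigenframe`, F0P3a-p05 (g17).)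
-/
import Literature.NumberTheory.Automorphic.UnitaryLatticeTreeDefs   -- ★ `unitaryGroupOfForm`, `StdForm.antidiagonal`, `HermitianLattice` vocabulary
import HarnessLib

/-!
# The lattice graph of a hermitian space — the characteristic polynomial of an element given in an EIGENFRAME `γ = A·diag(s)·A⁻¹` of the antidiagonal model is
# `(X − 1)(X − s₀)(X − s₂)` when `s₁ = 1` (Lang, *Algebra* XIV §3; Kottwitz 1986 §3)

Topic `NumberTheory/Automorphic`; namespace `Literature.NumberTheory.Automorphic.UnitaryLatticeTree`.  THEOREMS ONLY (no definition, no instance, no notation, no named fact,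
no `sorry`); kernel lane `--supports stmt-HodgeConjecture-24833`; datum-free (`K` any field, `σ` any ring endomorphism).  Cell `pub/hodgecm-mathlib` (D-0151), crux H413;
road «S3-ram» (Literature seeding, count-neutral), organ (e1)∕A′e, the JUNCTION (J★) `stub_signedStrataCount_typeOne_ram` of the junction pen F0P3a-p01 (g17), J-PACK v2
(03ef5f1f) §0 + skeleton v3 (44f18c65) ∕ v4 (e89e5e06): the ★ engine `strataVec_total_eq_of_localLaw_of_root` runs in the J₀-MODEL (`H₀ = (StdForm.antidiagonal 3).over K`)
for the literal written in its integral eigenframe `γ = A·diag(s)·A⁻¹ ∈ U(σ, H₀)` with `s 1 = 1` (the literal normalised by its middle eigenvalue, ★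
`exists_mem_unitaryInt_coe_eq_conj_diagonal_div`), and ROW-N ★ `UnitaryLatticeTreeNilpotencyTokenOfDepths` consumes its characteristic polynomial through the hypothesis
`hchar : charpoly γ = (X − C 1) * (X − C μ₁) * (X − C μ₂)`.  The pen booked that computation as a «socket to myself» (v3 :406 ∕ v4 :479); THIS FILE proves it, statement VERBATIM:

* `charpoly_coe_mul_diagonal_mul_coe_inv`: `charpoly (A·diag s·A⁻¹) = (X − s₀)(X − s₁)(X − s₂)` for `A ∈ GL₃(K)` (Mathlib `Matrix.charpoly_units_conj` + `Matrix.charpoly_diagonal`);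
* **`charpoly_of_eigenframe`** (the socket): `s 1 = 1` ⇒ `charpoly γ = (X − 1)(X − s₀)(X − s₂)` — plug `exact charpoly_of_eigenframe A s hs1 hγA`.
HONEST LABEL: HC_CM is proved only modulo the 2 remaining named inputs (hLiu418 24832, h413 24833) until rung 0 closes; nothing printed is asserted here (linear algebra).

## References
* [Lang2002] S. Lang, *Algebra*, 3rd ed. (2002), Ch. XIV §3 (the characteristic polynomial is a similarity invariant; diagonal matrices).
* [Kottwitz1986] R. E. Kottwitz, *Base change for unit elements of Hecke algebras*, Compositio Math. 60 (1986), §3 (counting fixed lattices of a regular element in an eigenbasis).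
-/

set_option autoImplicit false

noncomputable section

open scoped Matrix MatrixGroups
open Polynomial

namespace Literature.NumberTheory.Automorphic.UnitaryLatticeTree

open Literature.NumberTheory.Automorphic Literature.NumberTheory.Automorphic.HermitianLattice

variable {K : Type*} [Field K] {σ : K →+* K}

/-- `charpoly (A·diag(s)·A⁻¹) = (X − s₀)(X − s₁)(X − s₂)` for `A ∈ GL₃(K)` (similarity invariance + the diagonal case). [cite: Lang2002, Ch. XIV §3] -/
theorem charpoly_coe_mul_diagonal_mul_coe_inv (A : GL (Fin 3) K) (s : Fin 3 → K) :
    ((A : Matrix (Fin 3) (Fin 3) K) * Matrix.diagonal s * ((A⁻¹ : GL (Fin 3) K) : Matrix (Fin 3) (Fin 3) K)).charpoly =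
      (X - C (s 0)) * (X - C (s 1)) * (X - C (s 2)) := by
  rw [Matrix.coe_units_inv, Matrix.charpoly_units_conj, Matrix.charpoly_diagonal, Fin.prod_univ_three]

/-- **SOCKET `charpoly_of_eigenframe` (junction skeleton v3 44f18c65 :406 ∕ v4 e89e5e06 :479, statement VERBATIM)**: the characteristic polynomial of
`γ = A·diag(s)·A⁻¹ ∈ U(σ, H₀)` with `s 1 = 1` is `(X − 1)(X − s₀)(X − s₂)` — the `hchar` hypothesis of ROW-N ★ `UnitaryLatticeTreeNilpotencyTokenOfDepths`.
[cite: Lang2002, Ch. XIV §3] [cite: Kottwitz1986, §3] -/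
theorem charpoly_of_eigenframe {γ : unitaryGroupOfForm σ ((StdForm.antidiagonal 3).over K)} (A : GL (Fin 3) K) (s : Fin 3 → K) (hs1 : s 1 = 1)
    (hγA : ((γ : GL (Fin 3) K) : Matrix (Fin 3) (Fin 3) K) = (A : Matrix (Fin 3) (Fin 3) K) * Matrix.diagonal s * ((A⁻¹ : GL (Fin 3) K) : Matrix (Fin 3) (Fin 3) K)) :
    (((γ : GL (Fin 3) K) : Matrix (Fin 3) (Fin 3) K)).charpoly = (X - C 1) * (X - C (s 0)) * (X - C (s 2)) := by
  rw [hγA, charpoly_coe_mul_diagonal_mul_coe_inv, hs1, map_one]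
  ring

end Literature.NumberTheory.Automorphic.UnitaryLatticeTree

end
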